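import Literature.MathematicalPhysics.QuantumLattice.ReducedBCSTorus
import Literature.MathematicalPhysics.QuantumLattice.PairCorrelations
import Literature.MathematicalPhysics.QuantumLattice.KohnLuttinger
import HarnessLib

/-!
# Particle–particle patch pair operators on the fermionic torus

Topic `MathematicalPhysics/QuantumLattice` (definition item `defn-patchPairOperator`, wanted by
route `HubbardSuperconductivity/IntrinsicLargeN`, crux `OneOverNTransfer`: pair-patch
bosonisation in the particle–particle channel). Built on `ReducedBCSTorus.lean`, which owns the
Bloch modes `momentumAnnihilation k σ = c_{kσ} = L^{-d/2} Σ_x e^{-ik·x} c_{xσ}`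
(`k : TorusSite d L = (ℤ/Lℤ)^d`, physical momentum `2πk/L`), their CAR, the BCS pair modes
`pairMode k = b_k = c_{-k↓} c_{k↑}` with the hard-core boson algebra
(`pairMode_comm`, `pairMode_commutator_conjTranspose : [b_k, b_l†] = δ_{kl}(1 - n_{k↑} - n_{-k↓})`),
the unnormalised shell pair operator `pairOperator ĝ S = Σ_{k∈S} ĝ(k) b_k` and the shell
`torusEnergyShell`. This file adds:

* for a PATCH `P : Finset (TorusSite d L)` (a set of momenta — in the application an angular
  sector of the energy shell around the Fermi curve) and a complex weight (gap profile) `φ`, the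
  normalised **patch pair annihilator**
  `patchPairOperator P φ = B_P(φ) = n_P(φ)⁻¹ Σ_{k ∈ P} φ(k) b_k`, `n_P(φ)² = patchNormSq P φ = Σ_{k∈P} |φ k|²`
  — the particle–particle twin of the particle–hole patch operators
  `c*_α(k) = n_α(k)⁻¹ Σ_{p ∈ B_α} a*_p a*_{p∓k}` of Benedikter–Nam–Porta–Schlein–Seiringer
  (Invent. Math. 225 (2021), §5) and of the opposite-spin pair operators `b̂_{p,σ}` of
  Falconi–Giacomelli–Hainzl–Porta (Ann. Henri Poincaré 22 (2021), §4.1);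
  `pairOperator ĝ S = n_S(ĝ) • patchPairOperator S ĝ` (`pairOperator_eq_patchNorm_smul_patchPairOperator`);
* the approximate CCR, PROVED as exact operator identities:
  `[B_P(φ), B_Q(θ)] = 0`; `[B_P(φ), B_Q(θ)†] = (n_P n_Q)⁻¹ Σ_{k ∈ P ∩ Q} φ(k) conj θ(k) (1 - n_{k↑} - n_{-k↓})`,
  hence `= 0` for disjoint patches and `= 1 - 𝓔_P(φ)` for `P = Q`, `φ = θ`, where the defect
  `patchExcess P φ = 𝓔_P(φ) = n_P⁻² Σ_{k∈P} |φ k|² (n_{k↑} + n_{-k↓})` satisfies the operator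
  inequalities `0 ≤ 𝓔_P(φ) ≤ (max_P |φ|²) n_P⁻² 𝒩_P` with `patchNumber P = 𝒩_P = Σ_{k∈P} (n_{k↑} + n_{-k↓})`
  the number of excitations in the patch modes (the pattern of BNPSS Lemma 5.2 / 5.3:
  CCR defect ≲ (excitations in the patch)/(modes in the patch)), also in expectation-value form;
* `B_P(φ)` lowers the particle number by two and commutes with `S^z`
  (`IsNParticle.patchPairOperator_mulVec`, `spinZ_commute_patchPairOperator`, `patchPairOperator_mulVec_mem_szSector`);
* the decomposition `Σ_k φ(k) b_k = Σ_α n_α(φ) B_α(φ) + Σ_{k ∉ ⋃ P_α} φ(k) b_k` for a disjoint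
  patch family (`PatchFamily`, `PatchFamily.sum_smul_pair_add_sum_compl`);
* the bridge to the tree's position-space pair field (`d = 2`):
  `pairField g L = -Σ_k w_g(k) b_k` (`pairField_eq_neg_sum_pairFieldMode_smul_pairMode`) with
  `w_g(k) = pairFieldMode g L k = √2 Σ_{e ∈ {0} ∪ unitSteps} g(e) Re e^{ik·e}`; for the `d`-wave
  form factor `w_d(k) = 2√2 (cos p₁ - cos p₂) = 2√2 · dWaveGap k`, so that
  `pairField dWaveFormFactor L = -(2√2) • pairOperator dWaveGap univ`
  (`pairField_dWave_eq_smul_pairOperator`);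
* conveniences for building patches from a continuum dispersion `ε : Momentum → ℝ` of
  `KohnLuttinger.lean`: `toMomentum L k = 2πk/L`, `energyShell ε μ w L = {k : |ε(2πk/L) - μ| ≤ w}`,
  with `energyShell (squareDispersion 1 0) μ w L = torusEnergyShell 2 L μ w`.

## Design choices

* Patches are plain finite sets of momentum labels; the patch GEOMETRY (shell width, number
  `M ~ N* = (W/Δ)^{1/2}` of angular patches, corridors, antipodal pairing) is DATA supplied by the
  consumer — every statement here holds for arbitrary finite sets of momenta, and only pairwise
  disjointness enters (`PatchFamily`, indexed by `Fin M`). Weights are complex (gap profiles may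
  carry phases); `pairOperator` of `ReducedBCSTorus` is the real-weight, unnormalised case.
* Junk values: if `n_P(φ) = 0` (empty patch, or `φ` vanishing on `P`) then `B_P(φ) = 0` and
  `𝓔_P(φ) = 0` by Mathlib's `0⁻¹ = 0`; the normalised CCR `[B, B†] = 1 - 𝓔` is stated under
  `patchNormSq P φ ≠ 0`. `NeZero L` throughout (as in `ReducedBCSTorus`).
* `toMomentum` uses the representatives `2π k.val / L ∈ [0, 2π)` (`latticeMomentum`), immaterial
  for `2π`-periodic dispersions.
* Everything is proved; no named fact is introduced.

## Mathlib / tree search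

Mathlib: `Matrix.PosSemidef` (`posSemidef_conjTranspose_mul_self`, `PosSemidef.add`,
`posSemidef_sum`, `dotProduct_mulVec_nonneg`), `Commute.sum_left/right`, `EuclideanSpace`; no CAR
algebra, BCS pair operators or bosonisation (`lean search 'patchPairOperator|bosoniz|cooper'`: nothing).
Tree (`lean search`): `momentumAnnihilation`, `pairMode`, `pairOperator`, `torusEnergyShell`,
`dWaveGap`, `spinWeightedNumber_commutator_pairMode`, `pairMode_commutator_conjTranspose`,
`annihilation_orb_eq_sum_momentumAnnihilation`, `torusFourierWeight` (`ReducedBCSTorus`);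
`torusChar`, `sum_torusChar_right`, `torusChar_proj` (`TorusFourierProofs`,
`HubbardFreePropagator`); `pairField`, `localPair`, `dWaveFormFactor`, `unitSteps`
(`PairCorrelations`); `Momentum`, `squareDispersion` (`KohnLuttinger`);
`IsNParticle.annihilation_mulVec_holds`, `nParticleSubmodule`, `szSector`.

## References

* N. Benedikter, P. T. Nam, M. Porta, B. Schlein, R. Seiringer, *Correlation energy of a weakly
  interacting Fermi gas*, Invent. Math. 225 (2021) 885–979, §4 (patches), §5 (normalised patch
  pair operators `c*_α(k)` and the decomposition `b(k) = Σ_α n_α(k) c_α(k)`; Lemma 5.2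
  approximate CCR; Lemma 5.3 bosonic number operator). [BenedikterNamPortaSchleinSeiringer2021]
* M. Falconi, E. L. Giacomelli, C. Hainzl, M. Porta, *The dilute Fermi gas via Bogoliubov
  theory*, Ann. Henri Poincaré 22 (2021) 2283–2353, §4.1 (pair operators `b̂_{p,σ}` and their
  quasi-bosonic commutation relations). [FalconiGiacomelliHainzlPorta2021]
* J. Feldman, J. Magnen, V. Rivasseau, E. Trubowitz, *Two-dimensional many-fermion systems as
  vector models*, Europhys. Lett. 24 (1993) 521 (angular sectors of the Fermi curve).
  [FeldmanMagnenRivasseauTrubowitz1993Vector]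
* J. von Delft, D. C. Ralph, Phys. Rep. 345 (2001) 61, §4.2 (pair modes `b_j`, hard-core boson
  relations) [VondelftRalph2001]; D. J. Scalapino, Phys. Rep. 250 (1995) 329, §2 (the `d_{x²-y²}`
  pair field) [Scalapino1995].
-/

noncomputable section

namespace Literature.MathematicalPhysics.QuantumLattice

open Matrix Finset Literature.Probability.LatticeModels
open scoped ComplexOrder ComplexConjugate

variable {d L : ℕ} [NeZero L]

/-! ### Complements on the Bloch modes and the pair modes `b_k` -/

/-- `c_{kσ}` lowers the particle number by one. Bratteli–Robinson II §5.2.2. [folklore] -/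
theorem IsNParticle.momentumAnnihilation_mulVec {N : ℕ} {ψ : Fock (Orb (FermionTorus d L))}
    (hψ : IsNParticle (N + 1) ψ) (k : TorusSite d L) (σ : Fin 2) :
    IsNParticle N (momentumAnnihilation k σ *ᵥ ψ) := by
  unfold momentumAnnihilation
  rw [Matrix.sum_mulVec]
  refine Submodule.sum_mem (nParticleSubmodule N) fun x _ => ?_
  rw [smul_mulVec]
  exact (nParticleSubmodule N).smul_mem _ (IsNParticle.annihilation_mulVec_holds hψ _)

/-- **`b_k` lowers the particle number by two**: it maps the `(N+2)`-particle sector into the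
`N`-particle sector. von Delft–Ralph (2001) §4.2.3. [folklore] -/
theorem IsNParticle.pairMode_mulVec {N : ℕ} {ψ : Fock (Orb (FermionTorus d L))}
    (hψ : IsNParticle (N + 2) ψ) (k : TorusSite d L) : IsNParticle N (pairMode k *ᵥ ψ) := by
  rw [pairMode, ← mulVec_mulVec]
  exact (hψ.momentumAnnihilation_mulVec _ _).momentumAnnihilation_mulVec _ _

/-- `[N, b_k] = -2 b_k`, i.e. `N b_k = b_k (N - 2)` (the charge `f ≡ 1` of
`spinWeightedNumber_commutator_pairMode`). von Delft–Ralph (2001) §4.2.3. [folklore] -/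
theorem totalNumber_mul_pairMode_sub (k : TorusSite d L) :
    totalNumber * pairMode k - pairMode k * totalNumber = -(2 : ℂ) • pairMode k := by
  rw [totalNumber_eq_spinWeightedNumber, spinWeightedNumber_commutator_pairMode, ← neg_smul]
  norm_num

/-- **`[S^z, b_k] = 0`**: a singlet pair carries no spin (the charge `f = (½, -½)`).
Bardeen–Cooper–Schrieffer (1957) §II; von Delft–Ralph (2001) §4.2.3. [folklore] -/
theorem spinZ_commute_pairMode (k : TorusSite d L) : Commute HubbardWave0.spinZ (pairMode k) := by
  rw [Commute, SemiconjBy, ← sub_eq_zero, spinZ_eq_spinWeightedNumber,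
    spinWeightedNumber_commutator_pairMode]
  simp

/-- `n_{kσ} = (c_{kσ})ᴴ c_{kσ}` is positive semidefinite. [folklore] -/
theorem posSemidef_momentumNumber (k : TorusSite d L) (σ : Fin 2) : (momentumNumber k σ).PosSemidef :=
  posSemidef_conjTranspose_mul_self _

/-- `n_{k↑} + n_{-k↓} ≥ 0` (the occupation of the pair level `(k↑, -k↓)`). [folklore] -/
theorem posSemidef_momentumNumber_add (k : TorusSite d L) :
    (momentumNumber k 0 + momentumNumber (-k) 1).PosSemidef :=
  (posSemidef_momentumNumber k 0).add (posSemidef_momentumNumber (-k) 1)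

omit [NeZero L] in
/-- A nonnegative real multiple (cast to `ℂ`) of a positive semidefinite complex matrix is positive
semidefinite. [folklore] -/
theorem posSemidef_ofReal_smul {n : Type*} [Fintype n] {A : Matrix n n ℂ} (hA : A.PosSemidef)
    {r : ℝ} (hr : 0 ≤ r) : ((r : ℂ) • A).PosSemidef := by
  refine PosSemidef.of_dotProduct_mulVec_nonneg ?_ fun x => ?_
  · rw [IsHermitian, conjTranspose_smul, Complex.star_def, Complex.conj_ofReal, hA.1.eq]
  · rw [smul_mulVec, dotProduct_smul]
    exact smul_nonneg (Complex.zero_le_real.2 hr) (hA.dotProduct_mulVec_nonneg x)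

/-! ### Patch pair operators -/

section Patch

variable (P Q : Finset (TorusSite d L)) (φ θ : TorusSite d L → ℂ)

omit [NeZero L] in
/-- The squared normalisation `n_P(φ)² = Σ_{k ∈ P} |φ(k)|²` of the patch `P` with weight `φ`
(for `φ = 1` the number of pair modes in the patch; BNPSS's `n_α(k)²` = number of pairs in the
patch `B_α`). Benedikter–Nam–Porta–Schlein–Seiringer (2021) §5, display before Lemma 5.1.
[cite: BenedikterNamPortaSchleinSeiringer2021, §5] -/
def patchNormSq (P : Finset (TorusSite d L)) (φ : TorusSite d L → ℂ) : ℝ := ∑ k ∈ P, ‖φ k‖ ^ 2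

omit [NeZero L] in
/-- The normalisation `n_P(φ) = (Σ_{k ∈ P} |φ(k)|²)^{1/2}`.
Benedikter–Nam–Porta–Schlein–Seiringer (2021) §5. [cite: BenedikterNamPortaSchleinSeiringer2021, §5] -/
def patchNorm (P : Finset (TorusSite d L)) (φ : TorusSite d L → ℂ) : ℝ := Real.sqrt (patchNormSq P φ)

omit [NeZero L] in
/-- `n_P(φ)² ≥ 0`. [folklore] -/
theorem patchNormSq_nonneg : 0 ≤ patchNormSq P φ :=
  Finset.sum_nonneg fun k _ => by positivity

omit [NeZero L] in
/-- `n_P(φ) ≥ 0`. [folklore] -/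
theorem patchNorm_nonneg : 0 ≤ patchNorm P φ := Real.sqrt_nonneg _

omit [NeZero L] in
/-- `n_P(φ)² = patchNormSq P φ`. [folklore] -/
theorem patchNorm_sq : patchNorm P φ ^ 2 = patchNormSq P φ := Real.sq_sqrt (patchNormSq_nonneg P φ)

omit [NeZero L] in
/-- For the constant weight `1`, `n_P²` is the number of pair modes in the patch. [folklore] -/
theorem patchNormSq_one : patchNormSq P (fun _ => 1) = P.card := by
  simp [patchNormSq]

omit [NeZero L] in
/-- If `n_P(φ) = 0` then `φ` vanishes on the patch. [folklore] -/
theorem eq_zero_of_patchNormSq_eq_zero (h : patchNormSq P φ = 0) {k : TorusSite d L} (hk : k ∈ P) :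
    φ k = 0 := by
  have h' := (Finset.sum_eq_zero_iff_of_nonneg (fun k _ => by positivity)).1 h k hk
  exact norm_eq_zero.1 (pow_eq_zero_iff two_ne_zero |>.1 h')

/-- The **normalised patch pair annihilator** `B_P(φ) = n_P(φ)⁻¹ Σ_{k ∈ P} φ(k) b_k` of the patch
`P` (a finite set of momenta, in the application an angular sector of the energy shell around the
Fermi curve) with weight (gap profile) `φ`: the particle–particle analogue of the patch operators
`c_α(k) = n_α(k)⁻¹ Σ_{p ∈ B_α} a_{p-k} a_p` of Benedikter–Nam–Porta–Schlein–Seiringer (2021) §5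
(display before Lemma 5.1) and of the pair operators `b̂_{p,σ}` of Falconi–Giacomelli–Hainzl–Porta
(2021) §4.1. **Junk value**: `B_P(φ) = 0` if `n_P(φ) = 0` (`0⁻¹ = 0`).
[cite: BenedikterNamPortaSchleinSeiringer2021, §5] -/
def patchPairOperator (P : Finset (TorusSite d L)) (φ : TorusSite d L → ℂ) :
    Matrix (Finset (Orb (FermionTorus d L))) (Finset (Orb (FermionTorus d L))) ℂ :=
  (patchNorm P φ : ℂ)⁻¹ • ∑ k ∈ P, φ k • pairMode k

/-- The **CCR defect** `𝓔_P(φ) = n_P(φ)⁻² Σ_{k ∈ P} |φ(k)|² (n_{k↑} + n_{-k↓})` of the patch pair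
operator (`[B_P(φ), B_P(φ)†] = 1 - 𝓔_P(φ)`, `patchPairOperator_commutator_conjTranspose_self`): a weighted
count of the excitations present in the pair modes of the patch, divided by the (weighted) number
of modes — the analogue of BNPSS's `𝓔_α(k,k)`. **Junk value** `0` if `n_P(φ) = 0`.
Benedikter–Nam–Porta–Schlein–Seiringer (2021), Lemma 5.2 (the operator `𝓔_α(k,l)`).
[cite: BenedikterNamPortaSchleinSeiringer2021, Lemma 5.2] -/
def patchExcess (P : Finset (TorusSite d L)) (φ : TorusSite d L → ℂ) :
    Matrix (Finset (Orb (FermionTorus d L))) (Finset (Orb (FermionTorus d L))) ℂ :=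
  (patchNormSq P φ : ℂ)⁻¹ •
    ∑ k ∈ P, ((‖φ k‖ ^ 2 : ℝ) : ℂ) • (momentumNumber k 0 + momentumNumber (-k) 1)

/-- The **patch excitation number** `𝒩_P = Σ_{k ∈ P} (n_{k↑} + n_{-k↓})`: the number of fermions
occupying the pair modes `(k↑, -k↓)`, `k ∈ P` (the fermionic number operator that controls the
bosonic one, BNPSS Lemma 5.3). Benedikter–Nam–Porta–Schlein–Seiringer (2021), Lemma 5.3.
[cite: BenedikterNamPortaSchleinSeiringer2021, Lemma 5.3] -/
def patchNumber (P : Finset (TorusSite d L)) :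
    Matrix (Finset (Orb (FermionTorus d L))) (Finset (Orb (FermionTorus d L))) ℂ :=
  ∑ k ∈ P, (momentumNumber k 0 + momentumNumber (-k) 1)

/-- `n_P(φ) • B_P(φ) = Σ_{k ∈ P} φ(k) b_k` (also when `n_P(φ) = 0`, both sides then vanishing).
[folklore] -/
theorem patchNorm_smul_patchPairOperator :
    (patchNorm P φ : ℂ) • patchPairOperator P φ = ∑ k ∈ P, φ k • pairMode k := by
  rw [patchPairOperator, smul_smul]
  by_cases h : patchNormSq P φ = 0
  · have h0 : ∀ k ∈ P, φ k • pairMode k = 0 := fun k hk => by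
      rw [eq_zero_of_patchNormSq_eq_zero P φ h hk, zero_smul]
    rw [Finset.sum_eq_zero h0, smul_zero]
  · rw [mul_inv_cancel₀, one_smul]
    rw [Ne, Complex.ofReal_eq_zero, patchNorm, Real.sqrt_eq_zero (patchNormSq_nonneg P φ)]
    exact h

/-- The shell pair operator of `ReducedBCSTorus` is the normalisation times the patch pair operator
of the whole shell: `pairOperator ĝ S = n_S(ĝ) • B_S(ĝ)`. [folklore] -/
theorem pairOperator_eq_patchNorm_smul_patchPairOperator (ĝ : TorusSite d L → ℝ) (S : Finset (TorusSite d L)) :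
    pairOperator ĝ S =
      (patchNorm S (fun k => (ĝ k : ℂ)) : ℂ) • patchPairOperator S (fun k => (ĝ k : ℂ)) := by
  rw [patchNorm_smul_patchPairOperator, pairOperator]

/-- **`[B_P(φ), B_Q(θ)] = 0`**: patch pair annihilators commute (pure part of the approximate
CCR). Benedikter–Nam–Porta–Schlein–Seiringer (2021), Lemma 5.2 (`[c_α(k), c_β(l)] = 0`),
transposed to particle–particle pairs. [cite: BenedikterNamPortaSchleinSeiringer2021, Lemma 5.2] -/
theorem commute_patchPairOperator : Commute (patchPairOperator P φ) (patchPairOperator Q θ) := by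
  unfold patchPairOperator
  refine Commute.smul_left (Commute.smul_right ?_ _) _
  refine Commute.sum_left _ _ _ fun k _ => Commute.sum_right _ _ _ fun l _ => ?_
  exact Commute.smul_left (Commute.smul_right (pairMode_comm k l) _) _

/-- `[B_P(φ), B_Q(θ)] = 0`, as an equation. Benedikter–Nam–Porta–Schlein–Seiringer (2021),
Lemma 5.2. [cite: BenedikterNamPortaSchleinSeiringer2021, Lemma 5.2] -/
theorem patchPairOperator_comm : patchPairOperator P φ * patchPairOperator Q θ = patchPairOperator Q θ * patchPairOperator P φ :=
  (commute_patchPairOperator P Q φ θ).eq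

/-- Unnormalised mixed commutator:
`[Σ_{k∈P} φ(k) b_k, (Σ_{l∈Q} θ(l) b_l)†] = Σ_{k ∈ P ∩ Q} φ(k) conj θ(k) (1 - n_{k↑} - n_{-k↓})`
(from the hard-core boson commutator `pairMode_commutator_conjTranspose`). Bardeen–Cooper–Schrieffer
(1957) §II; von Delft–Ralph (2001) §4.2.3. [folklore] -/
theorem sum_smul_pairMode_commutator_conjTranspose :
    (∑ k ∈ P, φ k • pairMode k) * (∑ l ∈ Q, θ l • pairMode l)ᴴ -
        (∑ l ∈ Q, θ l • pairMode l)ᴴ * ∑ k ∈ P, φ k • pairMode k =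
      ∑ k ∈ P ∩ Q, (φ k * conj (θ k)) • (1 - momentumNumber k 0 - momentumNumber (-k) 1) := by
  classical
  have h1 : (∑ k ∈ P, φ k • pairMode k) * (∑ l ∈ Q, θ l • pairMode l)ᴴ =
      ∑ k ∈ P, ∑ l ∈ Q, (φ k * star (θ l)) • (pairMode k * (pairMode l)ᴴ) := by
    rw [conjTranspose_sum, Finset.sum_mul_sum]
    simp_rw [conjTranspose_smul, smul_mul_smul_comm]
  have h2 : (∑ l ∈ Q, θ l • pairMode l)ᴴ * (∑ k ∈ P, φ k • pairMode k) =
      ∑ k ∈ P, ∑ l ∈ Q, (φ k * star (θ l)) • ((pairMode l)ᴴ * pairMode k) := by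
    rw [conjTranspose_sum, Finset.sum_mul_sum, Finset.sum_comm]
    simp_rw [conjTranspose_smul, smul_mul_smul_comm, mul_comm (star (θ _)) (φ _)]
  rw [h1, h2, ← Finset.sum_sub_distrib]
  have hk : ∀ k ∈ P, ∑ l ∈ Q, (φ k * star (θ l)) • (pairMode k * (pairMode l)ᴴ) -
      ∑ l ∈ Q, (φ k * star (θ l)) • ((pairMode l)ᴴ * pairMode k) =
      if k ∈ Q then (φ k * conj (θ k)) • (1 - momentumNumber k 0 - momentumNumber (-k) 1) else 0 := by
    intro k _
    rw [← Finset.sum_sub_distrib]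
    have hl : ∀ l ∈ Q, (φ k * star (θ l)) • (pairMode k * (pairMode l)ᴴ) -
        (φ k * star (θ l)) • ((pairMode l)ᴴ * pairMode k) =
        if k = l then (φ k * conj (θ k)) • (1 - momentumNumber k 0 - momentumNumber (-k) 1) else 0 := by
      intro l _
      rw [← smul_sub, pairMode_commutator_conjTranspose]
      split_ifs with hkl
      · subst hkl; rfl
      · rw [smul_zero]
    rw [Finset.sum_congr rfl hl, Finset.sum_ite_eq]
  rw [Finset.sum_congr rfl hk, Finset.sum_ite_mem]

/-- **The mixed commutator of patch pair operators** (exact form of the approximate CCR):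
`[B_P(φ), B_Q(θ)†] = (n_P(φ) n_Q(θ))⁻¹ Σ_{k ∈ P ∩ Q} φ(k) conj θ(k) (1 - n_{k↑} - n_{-k↓})`.
For disjoint patches this vanishes (`patchPairOperator_commutator_conjTranspose_of_disjoint`); for `P = Q`,
`φ = θ` it is `1 - 𝓔_P(φ)` (`patchPairOperator_commutator_conjTranspose_self`) — the particle–particle
analogue of `[c_α(k), c_β(l)†] = δ_{αβ}(δ_{kl} + 𝓔_α(k,l))`, Benedikter–Nam–Porta–Schlein–Seiringer
(2021), Lemma 5.2. [cite: BenedikterNamPortaSchleinSeiringer2021, Lemma 5.2] -/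
theorem patchPairOperator_commutator_conjTranspose :
    patchPairOperator P φ * (patchPairOperator Q θ)ᴴ - (patchPairOperator Q θ)ᴴ * patchPairOperator P φ =
      ((patchNorm P φ : ℂ)⁻¹ * (patchNorm Q θ : ℂ)⁻¹) •
        ∑ k ∈ P ∩ Q, (φ k * conj (θ k)) • (1 - momentumNumber k 0 - momentumNumber (-k) 1) := by
  have hstar : star ((patchNorm Q θ : ℂ)⁻¹) = (patchNorm Q θ : ℂ)⁻¹ := by
    rw [star_inv₀, Complex.star_def, Complex.conj_ofReal]
  rw [patchPairOperator, patchPairOperator, conjTranspose_smul, hstar, smul_mul_smul_comm, smul_mul_smul_comm,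
    mul_comm ((patchNorm Q θ : ℂ)⁻¹), ← smul_sub, sum_smul_pairMode_commutator_conjTranspose]

/-- **Distinct patches are independent bosonic modes**: `[B_P(φ), B_Q(θ)†] = 0` for disjoint
`P`, `Q`. Benedikter–Nam–Porta–Schlein–Seiringer (2021), Lemma 5.2 (`δ_{αβ}`).
[cite: BenedikterNamPortaSchleinSeiringer2021, Lemma 5.2] -/
theorem patchPairOperator_commutator_conjTranspose_of_disjoint (h : Disjoint P Q) :
    patchPairOperator P φ * (patchPairOperator Q θ)ᴴ - (patchPairOperator Q θ)ᴴ * patchPairOperator P φ = 0 := by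
  rw [patchPairOperator_commutator_conjTranspose, Finset.disjoint_iff_inter_eq_empty.1 h, Finset.sum_empty,
    smul_zero]

/-- **Approximate CCR within a patch**: `[B_P(φ), B_P(φ)†] = 1 - 𝓔_P(φ)` whenever the patch is
non-degenerate (`n_P(φ) ≠ 0`). Benedikter–Nam–Porta–Schlein–Seiringer (2021), Lemma 5.2,
transposed to particle–particle pairs; Bardeen–Cooper–Schrieffer (1957) §II and von Delft–Ralph
(2001) §4.2.3 for a single mode. [cite: BenedikterNamPortaSchleinSeiringer2021, Lemma 5.2] -/
theorem patchPairOperator_commutator_conjTranspose_self (h : patchNormSq P φ ≠ 0) :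
    patchPairOperator P φ * (patchPairOperator P φ)ᴴ - (patchPairOperator P φ)ᴴ * patchPairOperator P φ = 1 - patchExcess P φ := by
  have hn : (patchNorm P φ : ℂ)⁻¹ * (patchNorm P φ : ℂ)⁻¹ = (patchNormSq P φ : ℂ)⁻¹ := by
    rw [← mul_inv, ← Complex.ofReal_mul, ← sq, patchNorm_sq]
  have hφ : ∀ k, φ k * conj (φ k) = ((‖φ k‖ ^ 2 : ℝ) : ℂ) := fun k => by
    rw [Complex.mul_conj, Complex.normSq_eq_norm_sq]
  rw [patchPairOperator_commutator_conjTranspose, Finset.inter_self, hn, patchExcess]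
  simp_rw [hφ, sub_sub, smul_sub, Finset.sum_sub_distrib, smul_sub, ← Finset.sum_smul, smul_smul]
  rw [← Complex.ofReal_sum, ← patchNormSq, inv_mul_cancel₀ (Complex.ofReal_ne_zero.2 h), one_smul]

/-- `𝓔_P(φ)` is self-adjoint. [folklore] -/
theorem patchExcess_conjTranspose : (patchExcess P φ)ᴴ = patchExcess P φ := by
  have h1 : star ((patchNormSq P φ : ℂ)⁻¹) = (patchNormSq P φ : ℂ)⁻¹ := by
    rw [star_inv₀, Complex.star_def, Complex.conj_ofReal]
  simp only [patchExcess, conjTranspose_smul, conjTranspose_sum, conjTranspose_add,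
    momentumNumber_conjTranspose, h1, Complex.star_def, Complex.conj_ofReal]

/-- **`𝓔_P(φ) ≥ 0`**. Benedikter–Nam–Porta–Schlein–Seiringer (2021), Lemma 5.2 / proof of Lemma 5.3
(`𝓔_α(k,k) ≤ 0` there, with the opposite sign convention `[c, c†] = 1 + 𝓔`).
[cite: BenedikterNamPortaSchleinSeiringer2021, Lemma 5.2] -/
theorem posSemidef_patchExcess : (patchExcess P φ).PosSemidef := by
  rw [patchExcess, ← Complex.ofReal_inv]
  refine posSemidef_ofReal_smul (posSemidef_sum _ fun k _ => ?_) (inv_nonneg.2 (patchNormSq_nonneg P φ))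
  exact posSemidef_ofReal_smul (posSemidef_momentumNumber_add k) (by positivity)

/-- `𝒩_P ≥ 0`. [folklore] -/
theorem posSemidef_patchNumber : (patchNumber P).PosSemidef :=
  posSemidef_sum _ fun k _ => posSemidef_momentumNumber_add k

/-- **The CCR defect is controlled by the patch excitation number**: if `|φ(k)|² ≤ C` on `P` then
`𝓔_P(φ) ≤ (C / n_P(φ)²) 𝒩_P` as operators (for `φ = 1`: defect ≤ (excitations in the patch) /
(number of pair modes in the patch) — the mechanism of Benedikter–Nam–Porta–Schlein–Seiringer
(2021), Lemma 5.2 (the bound `|𝓔_α|² ≤ C (M N^{-2/3+δ} 𝒩)²`, i.e. `|𝓔| ≲ 𝒩 / n_α²`), in the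
particle–particle setting, where it is an
exact one-sided bound). [cite: BenedikterNamPortaSchleinSeiringer2021, Lemma 5.2] -/
theorem posSemidef_smul_patchNumber_sub_patchExcess {C : ℝ} (hC : ∀ k ∈ P, ‖φ k‖ ^ 2 ≤ C) :
    (((C / patchNormSq P φ : ℝ) : ℂ) • patchNumber P - patchExcess P φ).PosSemidef := by
  have hrepr : ((C / patchNormSq P φ : ℝ) : ℂ) • patchNumber P - patchExcess P φ =
      ∑ k ∈ P, (((C - ‖φ k‖ ^ 2) / patchNormSq P φ : ℝ) : ℂ) •
        (momentumNumber k 0 + momentumNumber (-k) 1) := by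
    rw [patchNumber, patchExcess, Finset.smul_sum, Finset.smul_sum, ← Finset.sum_sub_distrib]
    refine Finset.sum_congr rfl fun k _ => ?_
    rw [smul_smul, ← sub_smul, ← Complex.ofReal_inv, ← Complex.ofReal_mul, ← Complex.ofReal_sub,
      sub_div, div_eq_inv_mul (‖φ k‖ ^ 2)]
  rw [hrepr]
  refine posSemidef_sum _ fun k hk => posSemidef_ofReal_smul (posSemidef_momentumNumber_add k) ?_
  exact div_nonneg (sub_nonneg.2 (hC k hk)) (patchNormSq_nonneg P φ)

/-- Expectation-value form of the defect bound: `0 ≤ ⟨ψ, 𝓔_P(φ) ψ⟩ ≤ (C / n_P(φ)²) ⟨ψ, 𝒩_P ψ⟩`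
for every Fock vector `ψ`, if `|φ|² ≤ C` on `P`. Benedikter–Nam–Porta–Schlein–Seiringer (2021),
Lemma 5.2. [cite: BenedikterNamPortaSchleinSeiringer2021, Lemma 5.2] -/
theorem re_expect_patchExcess_le {C : ℝ} (hC : ∀ k ∈ P, ‖φ k‖ ^ 2 ≤ C)
    (ψ : Fock (Orb (FermionTorus d L))) :
    0 ≤ (expect (patchExcess P φ) ψ).re ∧
      (expect (patchExcess P φ) ψ).re ≤ C / patchNormSq P φ * (expect (patchNumber P) ψ).re := by
  refine ⟨(Complex.nonneg_iff.1 ((posSemidef_patchExcess P φ).dotProduct_mulVec_nonneg ψ)).1, ?_⟩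
  have h := (Complex.nonneg_iff.1
    ((posSemidef_smul_patchNumber_sub_patchExcess P φ hC).dotProduct_mulVec_nonneg ψ)).1
  rw [sub_mulVec, dotProduct_sub, smul_mulVec, dotProduct_smul, Complex.sub_re,
    smul_eq_mul, Complex.re_ofReal_mul] at h
  unfold expect
  linarith

/-- **Few excitations ⇒ almost bosonic**: on a vector with at most `m` excitations in the patch
modes in mean, `⟨ψ, 𝒩_P ψ⟩ ≤ m ‖ψ‖²`, the CCR defect satisfies `⟨ψ, 𝓔_P(φ) ψ⟩ ≤ C m / n_P(φ)² · ‖ψ‖²`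
(BNPSS: "number of excitations in the patch / `n_α²`"). Benedikter–Nam–Porta–Schlein–Seiringer
(2021), Lemma 5.2 and Lemma 5.3. [cite: BenedikterNamPortaSchleinSeiringer2021, Lemma 5.2] -/
theorem re_expect_patchExcess_le_of_patchNumber_le {C m : ℝ} (hC : ∀ k ∈ P, ‖φ k‖ ^ 2 ≤ C)
    (hC0 : 0 ≤ C) {ψ : Fock (Orb (FermionTorus d L))}
    (hm : (expect (patchNumber P) ψ).re ≤ m * (star ψ ⬝ᵥ ψ).re) :
    (expect (patchExcess P φ) ψ).re ≤ C * m / patchNormSq P φ * (star ψ ⬝ᵥ ψ).re := by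
  have h := (re_expect_patchExcess_le P φ hC ψ).2
  have hc : 0 ≤ C / patchNormSq P φ := div_nonneg hC0 (patchNormSq_nonneg P φ)
  calc (expect (patchExcess P φ) ψ).re ≤ C / patchNormSq P φ * (expect (patchNumber P) ψ).re := h
    _ ≤ C / patchNormSq P φ * (m * (star ψ ⬝ᵥ ψ).re) := mul_le_mul_of_nonneg_left hm hc
    _ = C * m / patchNormSq P φ * (star ψ ⬝ᵥ ψ).re := by ring

/-- **The patch excitation number is bounded by the particle number**: `𝒩_P ≤ N` as operators
(`N - 𝒩_P = Σ_{k ∉ P} n_{k↑} + Σ_{k ∉ -P} n_{k↓} ≥ 0`, by `N = Σ_{kσ} n_{kσ}`,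
`totalNumber_eq_sum_momentumNumber`). Benedikter–Nam–Porta–Schlein–Seiringer (2021), Lemma 5.3
(the bosonic number operator is controlled by the fermionic one). [folklore] -/
theorem posSemidef_totalNumber_sub_patchNumber : (totalNumber - patchNumber P).PosSemidef := by
  classical
  have hneg : ∑ k ∈ P, momentumNumber (-k) (1 : Fin 2) =
      ∑ k ∈ P.image Neg.neg, momentumNumber k (1 : Fin 2) := by
    rw [Finset.sum_image fun k _ l _ (h : -k = -l) => neg_injective h]
  have hrepr : (totalNumber : Matrix (Finset (Orb (FermionTorus d L))) _ ℂ) - patchNumber P =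
      ∑ k ∈ Pᶜ, momentumNumber k 0 + ∑ k ∈ (P.image Neg.neg)ᶜ, momentumNumber k 1 := by
    rw [totalNumber_eq_sum_momentumNumber, patchNumber, Finset.sum_add_distrib, hneg]
    simp only [Fin.sum_univ_two, Finset.sum_add_distrib]
    rw [← Finset.sum_add_sum_compl P fun k => momentumNumber k (0 : Fin 2),
      ← Finset.sum_add_sum_compl (P.image Neg.neg) fun k => momentumNumber k (1 : Fin 2)]
    abel
  rw [hrepr]
  exact (posSemidef_sum _ fun k _ => posSemidef_momentumNumber k 0).add
    (posSemidef_sum _ fun k _ => posSemidef_momentumNumber k 1)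

/-- `⟨ψ, 𝒩_P ψ⟩ ≤ ⟨ψ, N ψ⟩` for every Fock vector. [folklore] -/
theorem re_expect_patchNumber_le_totalNumber (ψ : Fock (Orb (FermionTorus d L))) :
    (expect (patchNumber P) ψ).re ≤ (expect totalNumber ψ).re := by
  have h := (Complex.nonneg_iff.1
    ((posSemidef_totalNumber_sub_patchNumber P).dotProduct_mulVec_nonneg ψ)).1
  rw [sub_mulVec, dotProduct_sub, Complex.sub_re] at h
  unfold expect
  linarith

/-- On an `N`-particle vector, `⟨ψ, N ψ⟩ = N ‖ψ‖²` (any finite orbital lattice `Λ`).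
Bratteli–Robinson II §5.2.2. [folklore] -/
theorem IsNParticle.expect_totalNumber {Λ : Type*} [LinearOrder Λ] [Fintype Λ] {N : ℕ}
    {ψ : Fock (Orb Λ)} (hψ : IsNParticle N ψ) : expect totalNumber ψ = (N : ℂ) * (star ψ ⬝ᵥ ψ) := by
  have key : ∀ s : Finset (Orb Λ), (totalNumber *ᵥ ψ) s = (s.card : ℂ) * ψ s := fun s => by
    rw [← totalNumberOp_eq_totalNumber, totalNumberOp_eq_diagonal, mulVec_diagonal]
  rw [expect, dotProduct, dotProduct, Finset.mul_sum]
  refine Finset.sum_congr rfl fun s _ => ?_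
  rw [key, Pi.star_apply]
  by_cases hs : s.card = N
  · rw [hs]; ring
  · rw [hψ s hs, star_zero, zero_mul, zero_mul, mul_zero]

/-- **On an `N`-particle vector the patch excitation number is at most `N`**: `⟨ψ, 𝒩_P ψ⟩ ≤ N ‖ψ‖²`
(so `re_expect_patchExcess_le_of_patchNumber_le` applies with `m = N`; finer bounds need energy
information, cf. BNPSS Lemma 5.3 with the gapped number operator). [folklore] -/
theorem IsNParticle.re_expect_patchNumber_le {N : ℕ} {ψ : Fock (Orb (FermionTorus d L))}
    (hψ : IsNParticle N ψ) : (expect (patchNumber P) ψ).re ≤ N * (star ψ ⬝ᵥ ψ).re := by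
  have h := re_expect_patchNumber_le_totalNumber P ψ
  rw [hψ.expect_totalNumber, ← Complex.ofReal_natCast, Complex.re_ofReal_mul] at h
  exact h

/-- **`B_P(φ)` lowers the particle number by two**: it maps the `(N+2)`-particle sector into the
`N`-particle sector. Benedikter–Nam–Porta–Schlein–Seiringer (2021) §5 (pair operators change the
particle number by two). [folklore] -/
theorem IsNParticle.patchPairOperator_mulVec {N : ℕ} {ψ : Fock (Orb (FermionTorus d L))}
    (hψ : IsNParticle (N + 2) ψ) : IsNParticle N (patchPairOperator P φ *ᵥ ψ) := by
  rw [patchPairOperator, smul_mulVec, Matrix.sum_mulVec]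
  refine (nParticleSubmodule N).smul_mem _ (Submodule.sum_mem _ fun k _ => ?_)
  rw [smul_mulVec]
  exact (nParticleSubmodule N).smul_mem _ (hψ.pairMode_mulVec k)

/-- `[N, B_P(φ)] = -2 B_P(φ)`. Benedikter–Nam–Porta–Schlein–Seiringer (2021) §5. [folklore] -/
theorem totalNumber_mul_patchPairOperator_sub :
    totalNumber * patchPairOperator P φ - patchPairOperator P φ * totalNumber = -(2 : ℂ) • patchPairOperator P φ := by
  simp only [patchPairOperator, Finset.smul_sum, smul_smul, Finset.mul_sum, Finset.sum_mul, mul_smul_comm,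
    smul_mul_assoc, ← Finset.sum_sub_distrib, ← smul_sub, totalNumber_mul_pairMode_sub]
  refine Finset.sum_congr rfl fun k _ => ?_
  rw [mul_comm]

/-- **`B_P(φ)` preserves `S^z`**: `[S^z, B_P(φ)] = 0`. Benedikter–Nam–Porta–Schlein–Seiringer
(2021) §5; Bardeen–Cooper–Schrieffer (1957) §II (singlet pairs). [folklore] -/
theorem spinZ_commute_patchPairOperator : Commute HubbardWave0.spinZ (patchPairOperator P φ) := by
  unfold patchPairOperator
  exact (Commute.sum_right _ _ _ fun k _ => (spinZ_commute_pairMode k).smul_right _).smul_right _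

/-- `B_P(φ)` maps the joint sector `(N + 2, S^z = M)` into the sector `(N, S^z = M)`.
Benedikter–Nam–Porta–Schlein–Seiringer (2021) §5. [folklore] -/
theorem patchPairOperator_mulVec_mem_szSector {N : ℕ} {M : ℝ} {ψ : Fock (Orb (FermionTorus d L))}
    (hψ : ψ ∈ szSector (N + 2) M) : patchPairOperator P φ *ᵥ ψ ∈ szSector N M := by
  rw [mem_szSector_iff] at hψ ⊢
  refine ⟨hψ.1.patchPairOperator_mulVec P φ, ?_⟩
  rw [mulVec_mulVec, (spinZ_commute_patchPairOperator P φ).eq, ← mulVec_mulVec, hψ.2, mulVec_smul]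

end Patch

/-! ### Disjoint patch families and the decomposition of a weighted pair mode -/

/-- A family of `M` pairwise disjoint patches of momenta on the torus of side `L` (BNPSS's
`{B_α}_{α=1}^M`; the geometry — shell, angular sectors, corridors — is chosen by the user).
Benedikter–Nam–Porta–Schlein–Seiringer (2021) §4. [cite: BenedikterNamPortaSchleinSeiringer2021, §4] -/
structure PatchFamily (d L : ℕ) where
  /-- the number of patches -/
  M : ℕ
  /-- the patches `P_α`, `α < M` -/
  patch : Fin M → Finset (TorusSite d L)
  /-- distinct patches are disjoint -/
  disjoint : ∀ ⦃α β : Fin M⦄, α ≠ β → Disjoint (patch α) (patch β)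

namespace PatchFamily

variable (F : PatchFamily d L) (φ θ : TorusSite d L → ℂ)

omit [NeZero L] in
/-- The union `⋃_α P_α` of the patches (the bosonised region of momentum space).
Benedikter–Nam–Porta–Schlein–Seiringer (2021) §4. [cite: BenedikterNamPortaSchleinSeiringer2021, §4] -/
def support : Finset (TorusSite d L) := Finset.univ.biUnion F.patch

/-- The patch pair operator `B_α(φ)` of the `α`-th patch.
Benedikter–Nam–Porta–Schlein–Seiringer (2021) §5. [cite: BenedikterNamPortaSchleinSeiringer2021, §5] -/
def pair (α : Fin F.M) :
    Matrix (Finset (Orb (FermionTorus d L))) (Finset (Orb (FermionTorus d L))) ℂ :=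
  patchPairOperator (F.patch α) φ

/-- `[B_α(φ), B_β(θ)†] = 0` for `α ≠ β`. Benedikter–Nam–Porta–Schlein–Seiringer (2021), Lemma 5.2.
[cite: BenedikterNamPortaSchleinSeiringer2021, Lemma 5.2] -/
theorem pair_commutator_conjTranspose_of_ne {α β : Fin F.M} (h : α ≠ β) :
    F.pair φ α * (F.pair θ β)ᴴ - (F.pair θ β)ᴴ * F.pair φ α = 0 :=
  patchPairOperator_commutator_conjTranspose_of_disjoint _ _ _ _ (F.disjoint h)

/-- `[B_α(φ), B_α(φ)†] = 1 - 𝓔_{P_α}(φ)` for a non-degenerate patch.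
Benedikter–Nam–Porta–Schlein–Seiringer (2021), Lemma 5.2. [cite: BenedikterNamPortaSchleinSeiringer2021, Lemma 5.2] -/
theorem pair_commutator_conjTranspose_self {α : Fin F.M} (h : patchNormSq (F.patch α) φ ≠ 0) :
    F.pair φ α * (F.pair φ α)ᴴ - (F.pair φ α)ᴴ * F.pair φ α = 1 - patchExcess (F.patch α) φ :=
  patchPairOperator_commutator_conjTranspose_self _ _ h

/-- `[B_α(φ), B_β(θ)] = 0`. Benedikter–Nam–Porta–Schlein–Seiringer (2021), Lemma 5.2.
[cite: BenedikterNamPortaSchleinSeiringer2021, Lemma 5.2] -/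
theorem pair_comm (α β : Fin F.M) : F.pair φ α * F.pair θ β = F.pair θ β * F.pair φ α :=
  patchPairOperator_comm _ _ _ _

/-- **Decomposition of a weighted pair mode over the patches**:
`Σ_α n_α(φ) B_α(φ) + Σ_{k ∉ ⋃ P_α} φ(k) b_k = Σ_k φ(k) b_k` (the modes outside the patches —
corridors, the complement of the shell — are kept as they are), cf. BNPSS §5, the decomposition
`b^R(k) = Σ_α n_α(k) c_α(k)` displayed after the definition of `c_α(k)`, plus the corridor terms of
Lemma 4.1. [cite: BenedikterNamPortaSchleinSeiringer2021, §5] -/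
theorem sum_smul_pair_add_sum_compl :
    ∑ α, (patchNorm (F.patch α) φ : ℂ) • F.pair φ α + ∑ k ∈ F.supportᶜ, φ k • pairMode k =
      ∑ k, φ k • pairMode k := by
  have hdisj : Set.PairwiseDisjoint (↑(Finset.univ : Finset (Fin F.M))) F.patch :=
    fun α _ β _ hαβ => F.disjoint hαβ
  simp_rw [pair, patchNorm_smul_patchPairOperator]
  rw [← Finset.sum_biUnion hdisj, ← support, Finset.sum_add_sum_compl]

end PatchFamily

/-! ### The position-space pair field as a weighted pair mode -/

/-- `χ_k(x) χ_l(x) = χ_{k+l}(x)`. [folklore] -/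
theorem torusChar_mul_torusChar_left (k l x : TorusSite d L) :
    torusChar k x * torusChar l x = torusChar (k + l) x := by
  rw [torusChar_comm k, torusChar_comm l, torusChar_comm (k + l), torusChar_add_right]

/-- `χ_{-k}(x) = conj χ_k(x)`. [folklore] -/
theorem torusChar_neg_left (k x : TorusSite d L) : torusChar (-k) x = conj (torusChar k x) := by
  rw [torusChar_comm, torusChar_neg_right, torusChar_comm]

/-- **A pair of fields at fixed separation in momentum space**:
`Σ_x c_{xσ} c_{(x+e)τ} = Σ_k e^{-ik·e} c_{kσ} c_{-k,τ}` (total momentum zero; the orbitals are taken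
on the fermionic torus through `FermionTorus.ofTorusSite`, as in `localPair`).
Bardeen–Cooper–Schrieffer (1957) §II (reduction of the pairing interaction to the `b_k`). [folklore] -/
theorem sum_annihilation_mul_annihilation_shift (e : TorusSite d L) (σ τ : Fin 2) :
    ∑ x : TorusSite d L, annihilation (orb (FermionTorus.ofTorusSite x) σ) *
        annihilation (orb (FermionTorus.ofTorusSite (x + e)) τ) =
      ∑ k : TorusSite d L, conj (torusChar k e) • (momentumAnnihilation k σ * momentumAnnihilation (-k) τ) := by
  classical
  simp_rw [annihilation_orb_eq_sum_momentumAnnihilation, FermionTorus.toTorusSite_ofTorusSite,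
    Finset.sum_mul_sum, smul_mul_smul_comm]
  rw [Finset.sum_comm]
  refine Finset.sum_congr rfl fun k _ => ?_
  rw [Finset.sum_comm]
  simp_rw [← Finset.sum_smul]
  have hcoef : ∀ l : TorusSite d L,
      ∑ x : TorusSite d L, torusFourierWeight d L * torusChar k x *
        (torusFourierWeight d L * torusChar l (x + e)) =
        if -k = l then conj (torusChar k e) else 0 := by
    intro l
    have : ∀ x : TorusSite d L, torusFourierWeight d L * torusChar k x *
        (torusFourierWeight d L * torusChar l (x + e)) =
        torusFourierWeight d L * torusFourierWeight d L * torusChar l e * torusChar (k + l) x :=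
      fun x => by rw [torusChar_add_right, ← torusChar_mul_torusChar_left]; ring
    simp_rw [this]
    rw [← Finset.mul_sum, sum_torusChar_right]
    by_cases hkl : -k = l
    · subst hkl
      rw [add_neg_cancel, if_pos rfl, if_pos rfl, torusChar_neg_left]
      linear_combination conj (torusChar k e) * torusFourierWeight_mul_self_mul_pow (d := d) (L := L)
    · rw [if_neg (fun h => hkl (neg_eq_iff_add_eq_zero.2 h)), if_neg hkl, mul_zero]
  simp_rw [hcoef, ite_smul, zero_smul]
  rw [Finset.sum_ite_eq]
  simp

section PairFieldBridge

variable (g : Site 2 → ℝ)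

/-- The momentum profile of the pair field `Δ_g` of `PairCorrelations`:
`w_g(k) = √2 Σ_{e ∈ {0} ∪ unitSteps} g(e) Re e^{ik·e}` (`= 2√2 (cos p₁ - cos p₂)` for the `d`-wave
form factor, `pairFieldMode_dWaveFormFactor`). Scalapino, Phys. Rep. 250 (1995) 329, §2
(`Δ_d = Σ_k (cos k_x - cos k_y) c_{-k↓}c_{k↑}` up to normalisation). [folklore] -/
def pairFieldMode (g : Site 2 → ℝ) (L : ℕ) [NeZero L] (k : TorusSite 2 L) : ℝ :=
  Real.sqrt 2 * ∑ e ∈ insert 0 unitSteps, g e * (torusChar k (Torus.proj L e)).re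

/-- **The pair field is a weighted pair mode**: `Δ_g = pairField g L = -Σ_k w_g(k) b_k` with
`w_g = pairFieldMode g L` (Fourier expansion of the local singlet pairs
`c_{x↑}c_{x+e,↓} - c_{x↓}c_{x+e,↑}`; the sign comes from `c_{k↑} c_{-k↓} = -b_k`, the `√2` from
the tree's `g(e)/√2` normalisation of `localPair`). Scalapino, Phys. Rep. 250 (1995) 329, §2;
Bardeen–Cooper–Schrieffer (1957) §II. [folklore] -/
theorem pairField_eq_neg_sum_pairFieldMode_smul_pairMode :
    pairField g L = -∑ k : TorusSite 2 L, (pairFieldMode g L k : ℂ) • pairMode k := by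
  classical
  have hA : ∀ e : TorusSite 2 L, ∑ x : TorusSite 2 L,
      annihilation (orb (FermionTorus.ofTorusSite x) 0) *
        annihilation (orb (FermionTorus.ofTorusSite (x + e)) 1) =
      -∑ k : TorusSite 2 L, conj (torusChar k e) • pairMode k := by
    intro e
    rw [sum_annihilation_mul_annihilation_shift, ← Finset.sum_neg_distrib]
    refine Finset.sum_congr rfl fun k _ => ?_
    rw [pairMode, momentumAnnihilation_mul_eq_neg, smul_neg]
  have hB : ∀ e : TorusSite 2 L, ∑ x : TorusSite 2 L,
      annihilation (orb (FermionTorus.ofTorusSite x) 1) *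
        annihilation (orb (FermionTorus.ofTorusSite (x + e)) 0) =
      ∑ k : TorusSite 2 L, torusChar k e • pairMode k := by
    intro e
    rw [sum_annihilation_mul_annihilation_shift, ← Equiv.sum_comp (Equiv.neg (TorusSite 2 L))]
    refine Finset.sum_congr rfl fun k _ => ?_
    simp only [Equiv.neg_apply, neg_neg, torusChar_neg_left, Complex.conj_conj, pairMode]
  have hsqrt : Real.sqrt 2 * Real.sqrt 2 = 2 := Real.mul_self_sqrt zero_le_two
  have hne : Real.sqrt 2 ≠ 0 := by positivity
  have hcoef : ∀ k : TorusSite 2 L, ∑ e ∈ insert 0 unitSteps,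
      ((g e / Real.sqrt 2 : ℝ) : ℂ) * (conj (torusChar k (Torus.proj L e)) + torusChar k (Torus.proj L e)) =
      (pairFieldMode g L k : ℂ) := by
    intro k
    rw [pairFieldMode, Complex.ofReal_mul, Complex.ofReal_sum, Finset.mul_sum]
    refine Finset.sum_congr rfl fun e _ => ?_
    rw [add_comm, Complex.add_conj, ← Complex.ofReal_mul, ← Complex.ofReal_mul]
    congr 1
    rw [div_mul_eq_mul_div, div_eq_iff hne]
    linear_combination (-(g e * (torusChar k (Torus.proj L e)).re)) * hsqrt
  unfold pairField localPair
  rw [Finset.sum_comm]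
  simp_rw [← Finset.smul_sum, Finset.sum_sub_distrib, hA, hB]
  have hk : ∀ e : Site 2, ((g e / Real.sqrt 2 : ℝ) : ℂ) •
      (-∑ k : TorusSite 2 L, conj (torusChar k (Torus.proj L e)) • pairMode k -
        ∑ k : TorusSite 2 L, torusChar k (Torus.proj L e) • pairMode k) =
      -∑ k : TorusSite 2 L, (((g e / Real.sqrt 2 : ℝ) : ℂ) *
        (conj (torusChar k (Torus.proj L e)) + torusChar k (Torus.proj L e))) • pairMode k := by
    intro e
    rw [← neg_add', ← Finset.sum_add_distrib, smul_neg, Finset.smul_sum]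
    simp_rw [← add_smul, smul_smul]
  simp_rw [hk]
  rw [Finset.sum_neg_distrib, Finset.sum_comm]
  simp_rw [← Finset.sum_smul, hcoef]

omit [NeZero L] in
/-- A sum over `{0} ∪ unitSteps`, expanded over the five steps `0, e₁, -e₁, e₂, -e₂`. [folklore] -/
private theorem sum_insert_zero_unitSteps {M : Type*} [AddCommMonoid M] (f : Site 2 → M) :
    ∑ e ∈ insert 0 unitSteps, f e =
      f 0 + (f (Pi.single 0 1) + (f (-Pi.single 0 1) + (f (Pi.single 1 1) + f (-Pi.single 1 1)))) := by
  have h0 : (0 : Site 2) ∉ unitSteps := by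
    simp only [unitSteps, Finset.mem_insert, Finset.mem_singleton]; decide
  have h1 : (Pi.single 0 1 : Site 2) ∉
      ({-Pi.single 0 1, Pi.single 1 1, -Pi.single 1 1} : Finset (Site 2)) := by
    simp only [Finset.mem_insert, Finset.mem_singleton]; decide
  have h2 : (-Pi.single 0 1 : Site 2) ∉ ({Pi.single 1 1, -Pi.single 1 1} : Finset (Site 2)) := by
    simp only [Finset.mem_insert, Finset.mem_singleton]; decide
  have h3 : (Pi.single 1 1 : Site 2) ∉ ({-Pi.single 1 1} : Finset (Site 2)) := by
    simp only [Finset.mem_singleton]; decide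
  rw [Finset.sum_insert h0, unitSteps, Finset.sum_insert h1, Finset.sum_insert h2,
    Finset.sum_insert h3, Finset.sum_singleton]

/-- `Re χ_k(±eᵢ mod L) = cos pᵢ`, `p = 2πk/L`. Friedli–Velenik (2017) §10.4. [folklore] -/
theorem re_torusChar_proj_single (k : TorusSite 2 L) (i : Fin 2) (s : ℤˣ) :
    (torusChar k (Torus.proj L ((s : ℤ) • Pi.single i 1))).re = Real.cos (latticeMomentum L k i) := by
  have key : (torusChar k (Torus.proj L (Pi.single i 1))).re = Real.cos (latticeMomentum L k i) := by
    rw [torusChar_proj, mul_comm, ← Complex.ofReal_sum, Complex.exp_ofReal_mul_I_re]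
    congr 1
    rw [Finset.sum_eq_single i]
    · rw [Pi.single_eq_same, Int.cast_one, mul_one]
    · intro j _ hji
      rw [Pi.single_eq_of_ne hji, Int.cast_zero, mul_zero]
    · exact fun h => absurd (Finset.mem_univ i) h
  rcases Int.units_eq_one_or s with hs | hs
  · rw [hs, Units.val_one, one_smul, key]
  · have hneg : Torus.proj L ((s : ℤ) • Pi.single i 1) = -Torus.proj L (Pi.single i 1) := by
      rw [hs, Units.val_neg, Units.val_one, neg_smul, one_smul]
      funext j
      simp [Torus.proj]
    rw [hneg, torusChar_neg_right, Complex.conj_re, key]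

/-- **The `d`-wave profile**: `w_d(k) = pairFieldMode dWaveFormFactor L k = 2√2 (cos p₁ - cos p₂)`
`= 2√2 · dWaveGap k` (the requester's `ĝ_d(k) = 2(cos k₁ - cos k₂)` up to the tree's `√2`).
Scalapino, Phys. Rep. 250 (1995) 329, §2. [folklore] -/
theorem pairFieldMode_dWaveFormFactor (k : TorusSite 2 L) :
    pairFieldMode dWaveFormFactor L k = 2 * Real.sqrt 2 * dWaveGap k := by
  have hx : ∀ s : ℤˣ, (torusChar k (Torus.proj L ((s : ℤ) • Pi.single 0 1))).re =
      Real.cos (latticeMomentum L k 0) := fun s => re_torusChar_proj_single k 0 s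
  have hy : ∀ s : ℤˣ, (torusChar k (Torus.proj L ((s : ℤ) • Pi.single 1 1))).re =
      Real.cos (latticeMomentum L k 1) := fun s => re_torusChar_proj_single k 1 s
  have hx1 := hx 1; have hx2 := hx (-1); have hy1 := hy 1; have hy2 := hy (-1)
  simp only [Units.val_one, one_smul, Units.val_neg, neg_smul] at hx1 hx2 hy1 hy2
  have hg0 : dWaveFormFactor 0 = 0 := dWaveFormFactor_zero
  have hg1 : dWaveFormFactor (Pi.single 0 1) = 1 := if_pos (Or.inl rfl)
  have hg2 : dWaveFormFactor (-Pi.single 0 1) = 1 := if_pos (Or.inr rfl)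
  have hne1 : (Pi.single 1 1 : Site 2) ≠ Pi.single 0 1 := fun h => by simpa using congrFun h 0
  have hne2 : (Pi.single 1 1 : Site 2) ≠ -Pi.single 0 1 := fun h => by simpa using congrFun h 0
  have hne3 : (-Pi.single 1 1 : Site 2) ≠ Pi.single 0 1 := fun h => by simpa using congrFun h 0
  have hne4 : (-Pi.single 1 1 : Site 2) ≠ -Pi.single 0 1 := fun h => by simpa using congrFun h 1
  have hg3 : dWaveFormFactor (Pi.single 1 1) = -1 := by
    rw [dWaveFormFactor, if_neg (not_or.2 ⟨hne1, hne2⟩), if_pos (Or.inl rfl)]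
  have hg4 : dWaveFormFactor (-Pi.single 1 1) = -1 := by
    rw [dWaveFormFactor, if_neg (not_or.2 ⟨hne3, hne4⟩), if_pos (Or.inr rfl)]
  rw [pairFieldMode, sum_insert_zero_unitSteps, hg0, hg1, hg2, hg3, hg4, hx1, hx2, hy1, hy2, dWaveGap]
  ring

/-- **The tree's `d`-wave pair field is the `d`-wave pair operator of `ReducedBCSTorus`**:
`pairField dWaveFormFactor L = -(2√2) • pairOperator dWaveGap univ`, i.e.
`Δ_d = -2√2 Σ_k (cos p₁ - cos p₂) c_{-k↓} c_{k↑}`. Scalapino, Phys. Rep. 250 (1995) 329, §2.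
[folklore] -/
theorem pairField_dWave_eq_smul_pairOperator :
    pairField dWaveFormFactor L =
      -(((2 * Real.sqrt 2 : ℝ) : ℂ) • pairOperator dWaveGap (Finset.univ : Finset (TorusSite 2 L))) := by
  rw [pairField_eq_neg_sum_pairFieldMode_smul_pairMode, pairOperator, Finset.smul_sum]
  congr 1
  refine Finset.sum_congr rfl fun k _ => ?_
  rw [pairFieldMode_dWaveFormFactor, smul_smul, ← Complex.ofReal_mul]

end PairFieldBridge

/-! ### Energy shells of a continuum dispersion (building patches) -/

section Shell

/-- The continuum momentum `2πk/L ∈ [0, 2π)² ⊂ ℝ²` (`Momentum = EuclideanSpace ℝ (Fin 2)` of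
`KohnLuttinger.lean`) of the label `k ∈ (ℤ/Lℤ)²` (`latticeMomentum` as a Euclidean vector).
[folklore] -/
def toMomentum (L : ℕ) (k : TorusSite 2 L) : Momentum := WithLp.toLp 2 (latticeMomentum L k)

omit [NeZero L] in
/-- Coordinates of `toMomentum`. [folklore] -/
@[simp] theorem toMomentum_apply (k : TorusSite 2 L) (i : Fin 2) :
    toMomentum L k i = latticeMomentum L k i := rfl

/-- The **energy shell** of half-width `w` around the level `μ` of a dispersion `ε : Momentum → ℝ`,
as a finite set of momentum labels of the torus of side `L`: `{k : |ε(2πk/L) - μ| ≤ w}` — the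
region to be cut into patches (BNPSS: the shell of width `R` around the Fermi surface, §4).
Benedikter–Nam–Porta–Schlein–Seiringer (2021) §4. [cite: BenedikterNamPortaSchleinSeiringer2021, §4] -/
def energyShell (ε : Momentum → ℝ) (μ w : ℝ) (L : ℕ) [NeZero L] : Finset (TorusSite 2 L) :=
  Finset.univ.filter fun k => |ε (toMomentum L k) - μ| ≤ w

/-- Membership in the energy shell. [folklore] -/
@[simp] theorem mem_energyShell {ε : Momentum → ℝ} {μ w : ℝ} {k : TorusSite 2 L} :
    k ∈ energyShell ε μ w L ↔ |ε (toMomentum L k) - μ| ≤ w := by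
  simp [energyShell]

omit [NeZero L] in
/-- The nearest-neighbour band of `KohnLuttinger` on the momentum grid is the torus band of
`HubbardFreePropagator`: `squareDispersion 1 0 (2πk/L) = ε_L(k) = -2 (cos p₁ + cos p₂)`. [folklore] -/
theorem squareDispersion_toMomentum (k : TorusSite 2 L) :
    squareDispersion 1 0 (toMomentum L k) = torusBand L k := by
  simp only [squareDispersion, torusBand, Fin.sum_univ_two, toMomentum_apply]
  ring

/-- For the pure nearest-neighbour band the shell is `torusEnergyShell` of `ReducedBCSTorus`.
[folklore] -/
theorem energyShell_squareDispersion (μ w : ℝ) :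
    energyShell (squareDispersion 1 0) μ w L = torusEnergyShell 2 L μ w := by
  ext k
  rw [mem_energyShell, mem_torusEnergyShell, squareDispersion_toMomentum]

end Shell

end Literature.MathematicalPhysics.QuantumLattice
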